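import Mathlib.LinearAlgebra.Dimension.Finite
import Mathlib.LinearAlgebra.FiniteDimensional.Defs
import Mathlib.Algebra.Algebra.Basic
import HarnessLib

/-!
# Linear relations over a base field hold coordinatewise

Let `K` be an algebra over a field `k` and `γ₁, …, γₙ ∈ K`.  Expanding the `γᵢ` on a `k`-basis
`c₁, …, c_t` of their `k`-span, `γᵢ = ∑ₗ qᵢₗ cₗ` with `qᵢₗ ∈ k`, every linear relation
`∑ᵢ rᵢ γᵢ = 0` with coefficients `rᵢ ∈ k` holds column by column: `∑ᵢ rᵢ qᵢₗ = 0` for each `l`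
(`exists_algebraMap_coords`).  Equivalently: the solutions in `Kⁿ` of a system of linear
equations with coefficients in `k` are `K`-linear combinations of solutions in `kⁿ` (the
solution space is defined over `k`; flatness of `K` over `k` in its most elementary form).

Used with `k = ℚ`, `K = ℂ` for the rational structure of spaces of modular forms
(`Literature.NumberTheory.EllipticCurves.DeligneSerreProp27WeightReductionProofs`).

## References

* N. Bourbaki, *Algebra II*, Ch. II §8 (rational structures: a subspace defined by linear
  equations with coefficients in `k` is rational over `k`).
-/

namespace Literature.LinearAlgebra.BaseChange

/-- **Linear relations with coefficients in a base field hold coordinatewise.**  For a field `k`,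
a `k`-algebra `K` and a finite family `γ : ι → K`, there are `c : Fin t → K` and coordinates
`q i l ∈ k` with `γ i = ∑ₗ q i l · c l` such that every relation `∑ᵢ rᵢ γᵢ = 0` with `rᵢ ∈ k`
already holds columnwise, `∑ᵢ rᵢ q i l = 0` for all `l`: take for `c` a `k`-basis of the `k`-span
of the `γ i` and expand.  Equivalently, the `K`-solutions of a linear system with coefficients in
`k` are spanned by its `k`-solutions (Bourbaki, *Algebra II*, Ch. II §8). [folklore] -/
theorem exists_algebraMap_coords (k : Type*) {K : Type*} [Field k] [Ring K] [Algebra k K]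
    {ι : Type*} [Fintype ι] (γ : ι → K) :
    ∃ (t : ℕ) (c : Fin t → K) (q : ι → Fin t → k),
      (∀ i, γ i = ∑ l, algebraMap k K (q i l) * c l) ∧
      ∀ r : ι → k, ∑ i, algebraMap k K (r i) * γ i = 0 → ∀ l, ∑ i, r i * q i l = 0 := by
  classical
  set W : Submodule k K := Submodule.span k (Set.range γ) with hW
  haveI : FiniteDimensional k W := FiniteDimensional.span_of_finite k (Set.finite_range γ)
  set b := Module.finBasis k W with hb
  have hmem : ∀ i, γ i ∈ W := fun i ↦ Submodule.subset_span ⟨i, rfl⟩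
  refine ⟨Module.finrank k W, fun l ↦ (b l : K), fun i l ↦ b.repr ⟨γ i, hmem i⟩ l, ?_, ?_⟩
  · intro i
    have h1 := congrArg Subtype.val (b.sum_repr ⟨γ i, hmem i⟩)
    simp only [Submodule.coe_sum, Submodule.coe_smul_of_tower, Algebra.smul_def] at h1
    exact h1.symm
  · intro r hr l
    have hx0 : (∑ i, r i • (⟨γ i, hmem i⟩ : W)) = 0 := by
      apply Subtype.ext
      simp only [Submodule.coe_sum, Submodule.coe_smul_of_tower, Algebra.smul_def,
        ZeroMemClass.coe_zero]
      exact hr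
    have := congrArg (fun y : W ↦ b.repr y l) hx0
    simpa only [map_sum, map_smul, map_zero, Finsupp.coe_finsetSum, Finsupp.coe_smul,
      Finset.sum_apply, Pi.smul_apply, smul_eq_mul, Finsupp.coe_zero, Pi.zero_apply] using this

end Literature.LinearAlgebra.BaseChange
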